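import Summits.CriticalPhenomena.CardyFormulaZ2.Theorems.GluingContraction.Negative.BirthReadConnected
import Summits.CriticalPhenomena.CardyFormulaZ2.Theorems.CardyGluingRDEGluingContractionPsiCollapse

/-!
# `stub_shadowingZ` is FALSE (crux `GluingContraction`, stmt-CriticalPhenomena-8580, line `birth` = `registered`), Part C: the refutation

The registered stub `stub_shadowingZ` of the skeleton `Cruxes/GluingContraction/Lines/birth.lean`
(line `birth`, served as `registered`) of crux `CardyGluingRDE.GluingContraction` claims: for every
`m ≥ 1`, `σ > 0` there are `C, κ > 0` such that for every window `δ₀`, top resolution `K` and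
`ℤ²`-mesh `u ≤ δ₀/(C·2^K)` the true bond-`ℤ²` reading law at mesh `u/2^m` is within `C·2^{-κK}`
(multiresolution total variation of the primal coordinates) of the glued prediction
`Ψ^m(ℤ² law at mesh u)`, `Ψ_k = gluingRDE planarCoinGlue (uniform coins)`.  This file proves its
negation `stub_shadowingZ_false`, with the statement copied verbatim (the short names `PZ`, `Sq`,
`rseg`, `EZ`, `zVec`, `Psi`, `primalCoord`, `lawVec`, `emptyState`, `lawZ`, `predZ` below are
verbatim copies of the skeleton's definitions, which live in a non-importable `Cruxes/` module).

Proof.  Witness `m = 1`, `σ = 1`; given `C, κ` take `δ₀ = 1`, `K` large, `n = ⌈C⌉₊ + 3`,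
`u = 1/(n 2^K) ≤ δ₀/(C 2^K)`.
* **T1** (`lawZ_support_eqvGen`, from Part B `readZ_primal_eqvGen`): at this commensurable mesh
  every state in the support of the reading law is primal-connected, so by the landed collapse
  theorem `psiCollapse_allJoined_ge_real` (file `CardyGluingRDEGluingContractionPsiCollapse`) the
  glued prediction puts mass `≥ 1 − 3·2^{-2^K}` on the all-joined state, whence
  (`toReal_allJoined_le_lawVec`) its level-`0` all-joined coordinate is `≥ 1 − 3·2^{-2^K}`.
* **T2** (`zVec_allTrue_le`): the truth at mesh `u/2 = 1/(2N)` gives the all-joined level-`0`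
  matrix mass `≤ P(closed left side ↔ closed right side) ≤ h(N'-2, N'-2) ≤ 1 − c` (Part A
  `truth_subset`, duality at `p = 1/2` and RSW: `crossingProb_add_real_dualTBCrossing_holds`,
  `real_dualTBCrossing_succ`, `crossingProb_anti_left`, `HalfPlaneArm.crossingProb_ge_rsw`).
Hence the level-`0` term alone of the multiresolution sum is `≥ (c − 3·2^{-2^K})/2 > C·2^{-κK}`.

Also recorded: `lawZ_apply` (the `dite` in `lawZ` is always the first branch: `lawZ k δ₀ u S =
P_ℤ²(stateEventZ k δ₀ u S)`, via measurability of `readZ`).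
-/

namespace Summit.CriticalPhenomena.CardyFormulaZ2.Theorems

namespace StubShadowingZ

open Set Metric MeasureTheory Complex
open Literature.Probability.Percolation Literature.Probability.LatticeModels

/-! ### The Birth definitions mentioned by the stub (verbatim copies) -/

noncomputable section

open scoped BigOperators ENNReal

/-- Bond percolation on `ℤ²` at `p = 1/2` (the route's `PZ`). -/
abbrev PZ : Measure (BondConfig (Site 2)) := bondPercolation (zdGraph 2) half

/-- The open square window `(0, δ₀)²` (the route's `Sq`; also `Literature…sq`). -/
def Sq (δ₀ : ℝ) : Set ℂ := {z : ℂ | 0 < z.re ∧ z.re < δ₀ ∧ 0 < z.im ∧ z.im < δ₀}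

/-- The route's dyadic boundary segment `seg δ₀ j a` (coordinate parametrisation), verbatim. -/
def rseg (δ₀ : ℝ) (j : ℕ) (a : Fin 4 × Fin (2 ^ j)) : Set ℂ :=
  {z : ℂ | (a.1 = 0 ∧ z.im = 0 ∧ δ₀ * ((a.2 : ℕ) : ℝ) / 2 ^ j ≤ z.re ∧
      z.re ≤ δ₀ * (((a.2 : ℕ) : ℝ) + 1) / 2 ^ j) ∨
    (a.1 = 1 ∧ z.re = δ₀ ∧ δ₀ * ((a.2 : ℕ) : ℝ) / 2 ^ j ≤ z.im ∧
      z.im ≤ δ₀ * (((a.2 : ℕ) : ℝ) + 1) / 2 ^ j) ∨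
    (a.1 = 2 ∧ z.im = δ₀ ∧ δ₀ * ((a.2 : ℕ) : ℝ) / 2 ^ j ≤ z.re ∧
      z.re ≤ δ₀ * (((a.2 : ℕ) : ℝ) + 1) / 2 ^ j) ∨
    (a.1 = 3 ∧ z.re = 0 ∧ δ₀ * ((a.2 : ℕ) : ℝ) / 2 ^ j ≤ z.im ∧
      z.im ≤ δ₀ * (((a.2 : ℕ) : ℝ) + 1) / 2 ^ j)}

/-- The route's state cell `EZ δ₀ j u M` (bond-`ℤ²`, mesh `u`), verbatim. -/
def EZ (δ₀ : ℝ) (j : ℕ) (u : ℝ) (M : SegMatrix (2 ^ j)) : Set (BondConfig (Site 2)) :=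
  {ω | ∀ a b, ω ∈ discreteCrossing (Sq δ₀) u (rseg δ₀ j a) (rseg δ₀ j b) ↔ M a b = true}

/-- The bond-`ℤ²` reading vector at resolution `j` and mesh `u`: `M ↦ P_ℤ²(EZ M)`. -/
def zVec (δ₀ : ℝ) (j : ℕ) (u : ℝ) : SegMatrix (2 ^ j) → ℝ := fun M => PZ.real (EZ δ₀ j u M)

/-- **`Ψ_k`**: the planarity-corrected Langlands gluing RDE on laws of resolution-`k` square states,
`gluingRDE planarCoinGlue (uniform law on the 4k coins)`. -/
def Psi (k : ℕ) : PMF (BoxArcState k) → PMF (BoxArcState k) :=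
  gluingRDE (planarCoinGlue (k := k)) (PMF.uniformOfFintype (Fin 4 × Fin k → Bool))

/-- The primal matrix of a state in the ROUTE's coordinate indexing (`toCoord` converts the
counterclockwise positions of `BoxArcState` to the route's coordinate positions; it is an
involution). -/
def primalCoord {k : ℕ} (S : BoxArcState k) : SegMatrix k :=
  fun a b => S.primal (toCoord a) (toCoord b)

/-- Level-`j` coordinates of a law `μ` of resolution-`2^K` states: the real masses of the OR-fusion
`SegMatrix.coarsen K j` of its primal matrix (route indexing). -/
def lawVec (K j : ℕ) (μ : PMF (BoxArcState (2 ^ K))) : SegMatrix (2 ^ j) → ℝ :=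
  fun M => ((μ.map primalCoord).map (SegMatrix.coarsen K j) M).toReal

/-- The empty state (all entries `false`), used only as the value of a junk branch. -/
def emptyState (k : ℕ) : BoxArcState k := ⟨fun _ _ => false, fun _ _ => false⟩

open Classical in
/-- **The bond-`ℤ²` reading law** at resolution `k`, window `(0, δ₀)²`, mesh `u`: the law of
`readZ k δ₀ u` under `P_ℤ²`, i.e. `S ↦ P_ℤ²(stateEventZ k δ₀ u S)` (these masses always sum to `1`,
`hasSum_stateEventZ`; the `dite` only makes the definition total). -/
def lawZ (k : ℕ) (δ₀ u : ℝ) : PMF (BoxArcState k) :=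
  if h : HasSum (fun S => PZ (stateEventZ k δ₀ u S)) 1 then ⟨_, h⟩ else PMF.pure (emptyState k)

/-- **Glued `ℤ²` prediction**: `Ψ^m` applied to the `ℤ²` reading law at mesh `u`, top resolution
`2^K` (the model of `m` mesh-halvings of the square). -/
def predZ (K m : ℕ) (δ₀ u : ℝ) : PMF (BoxArcState (2 ^ K)) := (Psi (2 ^ K))^[m] (lawZ (2 ^ K) δ₀ u)

/-! ### The reading law is the law of `readZ` (copied from the skeleton) -/

/-- The Boolean indicator of a measurable predicate is measurable. [folklore] -/
theorem measurable_decide_pred {Ω : Type*} [MeasurableSpace Ω] {p : Ω → Prop} [DecidablePred p]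
    (hp : MeasurableSet {ω | p ω}) : Measurable fun ω => decide (p ω) := by
  refine measurable_to_countable' fun b => ?_
  cases b
  · have : (fun ω => decide (p ω)) ⁻¹' {false} = {ω | p ω}ᶜ := by
      ext ω; simp
    rw [this]; exact hp.compl
  · have : (fun ω => decide (p ω)) ⁻¹' {true} = {ω | p ω} := by
      ext ω; simp
    rw [this]; exact hp

/-- A map into `BoxArcState k` whose two matrix-valued components have measurable Boolean entries
is measurable (the σ-algebra on `BoxArcState k` is discrete, the state space finite). [folklore] -/
theorem measurable_boxArcState_mk {Ω : Type*} [MeasurableSpace Ω] {k : ℕ}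
    (P D : Ω → ArcRel k) (hP : ∀ a b, Measurable fun ω => P ω a b)
    (hD : ∀ a b, Measurable fun ω => D ω a b) :
    Measurable fun ω => (⟨P ω, D ω⟩ : BoxArcState k) := by
  have hG : Measurable fun ω => (P ω, D ω) :=
    (measurable_pi_lambda _ fun a => measurable_pi_lambda _ fun b => hP a b).prodMk
      (measurable_pi_lambda _ fun a => measurable_pi_lambda _ fun b => hD a b)
  refine measurable_to_countable' fun S => ?_
  have : (fun ω => (⟨P ω, D ω⟩ : BoxArcState k)) ⁻¹' {S} =
      (fun ω => (P ω, D ω)) ⁻¹' {(S.primal, S.dual)} := by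
    ext ω
    simp [BoxArcState.ext_iff]
  rw [this]
  exact hG (measurableSet_singleton _)

/-- `readZ k δ₀ u` is measurable (every mesh `u`). [folklore] -/
theorem measurable_readZ (k : ℕ) (δ₀ u : ℝ) : Measurable (readZ k δ₀ u) := by
  classical
  unfold readZ
  refine measurable_boxArcState_mk _ _ (fun a b => ?_) (fun a b => ?_)
  · exact measurable_decide_pred (measurableSet_discreteCrossing
      (Literature.Probability.Percolation.sq δ₀) u (ccwSeg δ₀ k a) (ccwSeg δ₀ k b))
  · exact measurable_decide_pred (measurable_dualConfig (measurableSet_discreteCrossing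
      (dualWindow u (Literature.Probability.Percolation.sq δ₀)) u
        (dualWindow u (ccwSeg δ₀ k a)) (dualWindow u (ccwSeg δ₀ k b))))

/-- The fibre masses of a measurable map into a finite discrete space sum to `1`. [folklore] -/
theorem hasSum_fibre {Ω S : Type*} [MeasurableSpace Ω] [MeasurableSpace S]
    [MeasurableSingletonClass S] [Fintype S] (μ : Measure Ω) [IsProbabilityMeasure μ] {f : Ω → S}
    (hf : Measurable f) : HasSum (fun s => μ (f ⁻¹' {s})) 1 := by
  have h := hasSum_fintype fun s => μ (f ⁻¹' {s})
  have htot : ∑ s, μ (f ⁻¹' {s}) = 1 := by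
    rw [← measure_biUnion_finset (fun s _ t _ hst => ?_) fun s _ => hf (measurableSet_singleton s)]
    · have : (⋃ s ∈ (Finset.univ : Finset S), f ⁻¹' {s}) = univ :=
        eq_univ_of_forall fun ω => mem_iUnion₂.2 ⟨f ω, Finset.mem_univ _, rfl⟩
      rw [this, measure_univ]
    · exact Set.disjoint_iff.2 fun ω ⟨h₁, h₂⟩ => hst ((mem_singleton_iff.1 h₁).symm.trans h₂)
  rwa [htot] at h

/-- The `ℤ²` state masses sum to `1` (every mesh). [folklore] -/
theorem hasSum_stateEventZ (k : ℕ) (δ₀ u : ℝ) :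
    HasSum (fun S => PZ (stateEventZ k δ₀ u S)) 1 :=
  hasSum_fibre PZ (measurable_readZ k δ₀ u)

/-- **`lawZ` is the reading law**: `lawZ k δ₀ u S = P_ℤ²(stateEventZ k δ₀ u S)`. [folklore] -/
theorem lawZ_apply (k : ℕ) (δ₀ u : ℝ) (S : BoxArcState k) :
    lawZ k δ₀ u S = PZ (stateEventZ k δ₀ u S) := by
  rw [lawZ, dif_pos (hasSum_stateEventZ k δ₀ u)]
  rfl

/-! ### T1 at law level, T2, and the level-`0` prediction mass -/

/-- States in the support of the reading law are read states. [folklore] -/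
theorem exists_readZ_of_mem_support {k : ℕ} {δ₀ u : ℝ} {S : BoxArcState k}
    (hS : S ∈ (lawZ k δ₀ u).support) : ∃ ω, readZ k δ₀ u ω = S := by
  rw [PMF.mem_support_iff, lawZ_apply] at hS
  obtain ⟨ω, hω⟩ := nonempty_of_measure_ne_zero hS
  exact ⟨ω, hω⟩

/-- **T1 at law level**: at the commensurable meshes `u = 1/(n k)`, `n ≥ 2`, every state in the
support of the `ℤ²` reading law `lawZ k 1 u` is primal-connected. [folklore] -/
theorem lawZ_support_eqvGen {k n N : ℕ} (hk : 1 ≤ k) (hn : 2 ≤ n) (hN : N = n * k) :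
    ∀ S ∈ (lawZ k 1 (N : ℝ)⁻¹).support, ∀ a b : Fin 4 × Fin k,
      Relation.EqvGen (fun x y => S.primal x y = true) a b := by
  intro S hS a b
  obtain ⟨ω, rfl⟩ := exists_readZ_of_mem_support hS
  exact readZ_primal_eqvGen hk hn hN ω a b

/-- The route's window at `δ₀ = 1` is the open unit square. [folklore] -/
theorem Sq_one : Sq 1 = (Set.Ioo 0 1 ×ℂ Set.Ioo 0 1) := by
  ext z
  simp only [Sq, mem_reProdIm, mem_setOf_eq, mem_Ioo]
  tauto

/-- At level `0`, the route's segment `(3, 0)` is the closed left side of the unit square.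
[folklore] -/
theorem rseg_zero_left :
    rseg 1 0 ((3 : Fin 4), (0 : Fin (2 ^ 0))) = {z : ℂ | z.re = 0 ∧ 0 ≤ z.im ∧ z.im ≤ 1} := by
  ext z; simp [rseg]

/-- At level `0`, the route's segment `(1, 0)` is the closed right side of the unit square.
[folklore] -/
theorem rseg_zero_right :
    rseg 1 0 ((1 : Fin 4), (0 : Fin (2 ^ 0))) = {z : ℂ | z.re = 1 ∧ 0 ≤ z.im ∧ z.im ≤ 1} := by
  ext z; simp [rseg]

/-- **T2 — the truth is bounded away from `1`.** There is `c > 0` (RSW at aspect ratio `2`) such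
that at every mesh `1/N`, `N ≥ 5`, the level-`0` `ℤ²` reading mass of the all-joined matrix is
at most `1 - c`: the cell lies in the crossing "closed left side ↔ closed right side", i.e.
(`truth_subset`) in the long-way crossing `LR((1,1) + [0,N-2]²)`, whose probability is
`h(N-2, N-2) = 1 - h(N-1, N-3) ≤ 1 - h(2(N-3), N-3) ≤ 1 - c` (duality at `p = 1/2`,
`crossingProb_anti_left`, `HalfPlaneArm.crossingProb_ge_rsw`). [folklore] -/
theorem zVec_allTrue_le : ∃ c : ℝ, 0 < c ∧ ∀ N : ℕ, 5 ≤ N →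
    zVec 1 0 (N : ℝ)⁻¹ (fun _ _ => true) ≤ 1 - c := by
  obtain ⟨c, hc, hrsw⟩ := HalfPlaneArm.crossingProb_ge_rsw (k := 2) le_rfl
  refine ⟨c, hc, fun N hN => ?_⟩
  obtain ⟨L, rfl⟩ : ∃ L, N = L + 3 := ⟨N - 3, by omega⟩
  have hsub : EZ 1 0 ((L + 3 : ℕ) : ℝ)⁻¹ (fun _ _ => true) ⊆
      lrCrossingAt ![1, 1] (L + 1) (L + 1) := by
    intro ω hω
    have h := (hω ((3 : Fin 4), (0 : Fin (2 ^ 0))) ((1 : Fin 4), (0 : Fin (2 ^ 0)))).2 rfl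
    rw [Sq_one, rseg_zero_left, rseg_zero_right] at h
    have h' := truth_subset (N := L + 3) (by omega) h
    rwa [show L + 3 - 2 = L + 1 by omega] at h'
  have h1 : zVec 1 0 ((L + 3 : ℕ) : ℝ)⁻¹ (fun _ _ => true) ≤ crossingProb half (L + 1) (L + 1) := by
    rw [← bondPercolation_real_lrCrossingAt half ![1, 1] (L + 1) (L + 1)]
    exact measureReal_mono hsub
  have h2 : crossingProb half (L + 1) (L + 1) = 1 - crossingProb half (L + 1 + 1) L := by
    have h := crossingProb_add_real_dualTBCrossing_holds half (L + 1) (L + 1)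
    rw [real_dualTBCrossing_succ, symm_half] at h
    linarith
  have h3 : c ≤ crossingProb half (L + 1 + 1) L :=
    (hrsw L).trans (crossingProb_anti_left half (by omega) L)
  linarith

/-- The level-`0` coordinate of the all-joined matrix dominates the mass of the all-joined states
(coarsening an all-`true` matrix gives the all-`true` matrix). [folklore] -/
theorem toReal_allJoined_le_lawVec {K : ℕ} (μ : PMF (BoxArcState (2 ^ K))) :
    (μ.toOuterMeasure {S : BoxArcState (2 ^ K) | ∀ a b, S.primal a b = true}).toReal ≤
      lawVec K 0 μ (fun _ _ => true) := by
  unfold lawVec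
  rw [← PMF.toOuterMeasure_apply_singleton ((μ.map primalCoord).map (SegMatrix.coarsen K 0)),
    PMF.toOuterMeasure_map_apply, PMF.toOuterMeasure_map_apply]
  refine ENNReal.toReal_mono (ne_top_of_le_ne_top (measure_ne_top _ _)
    (μ.toOuterMeasure_apply_le_toMeasure_apply _)) (μ.toOuterMeasure_mono fun S hS => ?_)
  have hsub : ∀ i j : Fin (2 ^ 0), i = j := fun i j =>
    Fin.ext (by have := i.isLt; have := j.isLt; simp only [pow_zero] at *; omega)
  show SegMatrix.coarsen K 0 (primalCoord S) = fun _ _ => true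
  funext a b
  exact (SegMatrix.coarsen_apply_eq_true_iff K 0 _ a b).2
    ⟨⟨0, Nat.two_pow_pos K⟩, ⟨0, Nat.two_pow_pos K⟩, hsub _ _, hsub _ _, hS.1 _ _⟩

/-! ### The refutation -/

/-- **`stub_shadowingZ` is FALSE** (registered stub of the birth skeleton of crux
`CardyGluingRDE.GluingContraction`, stmt-CriticalPhenomena-8580): the `m`-fold glued prediction
`Ψ^m(lawZ)` does NOT shadow the true `ℤ²` law. Witness: `m = 1`,
`σ = 1`; given `C, κ` take `δ₀ = 1`, `K` large, `n = ⌈C⌉₊ + 3`, `u = 1/(n 2^K) ≤ δ₀/(C 2^K)`. At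
this commensurable mesh every read state is primal-connected (T1, tie vertices under the common
endpoints of adjacent segments, `discreteArc` compares with `≤`), so by the collapse lemma
`psiCollapse_allJoined_ge_real` the glued prediction puts mass `≥ 1 - 3·2^{-2^K}` on the
all-joined state, whence its level-`0` all-joined
coordinate is `≥ 1 - 3·2^{-2^K}`; the truth at mesh `u/2 = 1/(2N)` gives the all-joined level-`0`
matrix mass `≤ P(left ↔ right) ≤ 1 - c` (T2, RSW). Hence the level-`0` term alone of the
multiresolution sum is `≥ (c - 3·2^{-2^K})/2 ≥ c/4 > C·2^{-κK}`. [folklore] -/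
theorem stub_shadowingZ_false :
    ¬ (∀ m : ℕ, 1 ≤ m → ∀ σ : ℝ, 0 < σ → ∃ C κ : ℝ, 0 < C ∧ 0 < κ ∧
      ∀ δ₀ : ℝ, 0 < δ₀ → ∀ (K : ℕ) (u : ℝ), 0 < u → u ≤ δ₀ / (C * 2 ^ K) →
        multiResSum σ K (fun j => tvFin (zVec δ₀ j (u / 2 ^ m)) (lawVec K j (predZ K m δ₀ u)))
          ≤ C * (2 : ℝ) ^ (-(κ * (K : ℝ)))) := by
  intro H
  obtain ⟨C, κ, hC, hκ, H⟩ := H 1 le_rfl 1 one_pos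
  obtain ⟨c, hc, hcN⟩ := zVec_allTrue_le
  -- choice of the top resolution `K`: both slacks below `c/8`
  have hr1 : (2 : ℝ) ^ (-κ) < 1 := Real.rpow_lt_one_of_one_lt_of_neg one_lt_two (neg_neg_of_pos hκ)
  have hr0 : 0 ≤ (2 : ℝ) ^ (-κ) := Real.rpow_nonneg zero_le_two _
  obtain ⟨K₁, hK₁⟩ := exists_pow_lt_of_lt_one (show 0 < c / (8 * C) by positivity) hr1
  obtain ⟨K₂, hK₂⟩ := exists_pow_lt_of_lt_one (show 0 < c / 8 by positivity)
    (one_half_lt_one (α := ℝ))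
  set K := K₁ + K₂ with hKdef
  -- the commensurable mesh `u = 1/N`, `N = n 2^K`, `n = ⌈C⌉₊ + 3`
  set n := ⌈C⌉₊ + 3 with hndef
  set N := n * 2 ^ K with hNdef
  clear_value N
  have hk1 : 1 ≤ 2 ^ K := Nat.one_le_two_pow
  have hN3 : 3 ≤ N := by
    rw [hNdef]; exact le_trans (by norm_num) (Nat.mul_le_mul (show 3 ≤ n by omega) hk1)
  have hN0 : (0 : ℝ) < N := by exact_mod_cast (show 0 < N by omega)
  have hNr : (N : ℝ) = n * 2 ^ K := by rw [hNdef]; push_cast; ring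
  have hCn : C ≤ n := (Nat.le_ceil C).trans (by rw [hndef]; push_cast; linarith)
  have hu : (N : ℝ)⁻¹ ≤ 1 / (C * 2 ^ K) := by
    rw [one_div]
    refine inv_anti₀ (by positivity) ?_
    rw [hNr]
    exact mul_le_mul_of_nonneg_right hCn (by positivity)
  have key := H 1 one_pos K (N : ℝ)⁻¹ (inv_pos.2 hN0) hu
  -- level `0` of the multiresolution sum and its all-joined coordinate
  set d : ℕ → ℝ := fun j =>
    tvFin (zVec 1 j ((N : ℝ)⁻¹ / 2 ^ 1)) (lawVec K j (predZ K 1 1 (N : ℝ)⁻¹)) with hd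
  have hd0 : d 0 ≤ multiResSum 1 K d := by
    have := weight_mul_le_multiResSum (σ := 1) (d := d) (fun i => tvFin_nonneg _ _) (Nat.zero_le K)
    rwa [multiResWeight_zero, one_mul] at this
  have hgap : (1 / 2 : ℝ) * |zVec 1 0 ((N : ℝ)⁻¹ / 2 ^ 1) (fun _ _ => true) -
      lawVec K 0 (predZ K 1 1 (N : ℝ)⁻¹) (fun _ _ => true)| ≤ d 0 :=
    mul_le_mul_of_nonneg_left (Finset.single_le_sum
      (f := fun M => |zVec 1 0 ((N : ℝ)⁻¹ / 2 ^ 1) M - lawVec K 0 (predZ K 1 1 (N : ℝ)⁻¹) M|)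
      (fun M _ => abs_nonneg _) (Finset.mem_univ _)) (by norm_num)
  -- T2: the truth at mesh `u/2 = 1/(2N)`
  have hz : zVec 1 0 ((N : ℝ)⁻¹ / 2 ^ 1) (fun _ _ => true) ≤ 1 - c := by
    have : (N : ℝ)⁻¹ / 2 ^ 1 = ((2 * N : ℕ) : ℝ)⁻¹ := by
      rw [Nat.cast_mul, Nat.cast_ofNat, mul_inv_rev, pow_one, div_eq_mul_inv]
    rw [this]
    exact hcN (2 * N) (by omega)
  -- T1 + collapse: the prediction
  have hl : 1 - 3 * (2 : ℝ)⁻¹ ^ (2 ^ K) ≤ lawVec K 0 (predZ K 1 1 (N : ℝ)⁻¹) (fun _ _ => true) :=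
    (psiCollapse_allJoined_ge_real (2 ^ K) _ (lawZ_support_eqvGen hk1 (by omega) hNdef)
      subset_rfl).trans (toReal_allJoined_le_lawVec _)
  -- the two slacks
  have hs1 : 3 * (2 : ℝ)⁻¹ ^ (2 ^ K) ≤ c / 2 := by
    have : (2 : ℝ)⁻¹ ^ (2 ^ K) ≤ (1 / 2 : ℝ) ^ K₂ := by
      rw [one_div]
      exact pow_le_pow_of_le_one (by norm_num) (by norm_num)
        ((Nat.le_add_left K₂ K₁).trans Nat.lt_two_pow_self.le)
    linarith
  have hs2 : C * (2 : ℝ) ^ (-(κ * (K : ℝ))) < c / 8 := by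
    rw [← neg_mul, Real.rpow_mul (by norm_num), Real.rpow_natCast]
    calc C * ((2 : ℝ) ^ (-κ)) ^ K ≤ C * ((2 : ℝ) ^ (-κ)) ^ K₁ :=
          mul_le_mul_of_nonneg_left (pow_le_pow_of_le_one hr0 hr1.le (Nat.le_add_right K₁ K₂)) hC.le
      _ < C * (c / (8 * C)) := mul_lt_mul_of_pos_left hK₁ hC
      _ = c / 8 := by field_simp
  have habs := le_abs_self (lawVec K 0 (predZ K 1 1 (N : ℝ)⁻¹) (fun _ _ => true) -
      zVec 1 0 ((N : ℝ)⁻¹ / 2 ^ 1) (fun _ _ => true))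
  rw [abs_sub_comm] at habs
  linarith

end

end StubShadowingZ

end Summit.CriticalPhenomena.CardyFormulaZ2.Theorems
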